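import Summits.BirchSwinnertonDyer.BirchSwinnertonDyer.Theorems.PrintCf2SplitBadTwoStrictDefectDichotomy
import Summits.BirchSwinnertonDyer.BirchSwinnertonDyer.Theorems.PrintCf2SplitBadTwoLocNilSurjectiveInfinite
import HarnessLib

/-!
# Crux `PrintCf2.SplitBadTwoRankOneOfFacts` (stmt-BirchSwinnertonDyer-20368), skeleton v13.1, stub S3d `stub_strictDefectAtVbar_two`
# (= route-C item 24036 `StrictDefectAtVbarTwo`) — the ALGEBRAIC SPINE, part IV: the CLASS-(iii) SOCKET END TO END —
# `(S_nr)_Γ = 0` ∧ `𝔖 ≠ S_nr` ⟹ `Q = S_nr ⧸ 𝔖` infinite ⟹ (part III) `ord_p H'(0) = n + χ(Def)`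

Cell `bsd-print-cf2`, EXTRA WIDTH seat `bsd-line-cf2-p1-w3` g11 (prover-bsd-line-cf2-p1-w3-g11-0); `--supports stmt-BirchSwinnertonDyer-20368`
(helper, Theses-free). HONEST FRAMING: nothing here closes the crux or the registered stub S3d; BSD is not proved by any of this; no summit
statement is proved by this seat. No definition, no named fact, no `sorry`. Sequel of parts I–III (`…DualPairKernel`, `…StrictDatumOfUnrDatum`,
`…StrictDefectDichotomy`) and of -w7 g5's `…LocNilSurjectiveInfinite` (p691114).

WHAT (generic number field `K`, prime `p`, `ℤ_p`-line `κ` with topological generator `γ`, discrete `p`-primary `M` with open stabilisers, place `𝔮`;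
`S_nr := unrSelmer κ M 𝔮 ∅`, `𝔖 := restrictedSelmerZp κ M 𝔮`, `N := 𝔖.addSubgroupOf S_nr`, `Q := S_nr ⧸ N`).
* §1 **`surjective_of_natCard_endCoinvariants_eq_one`** — `#S_{ψ} = 1 ⟹ ψ` onto (generic); **`not_finite_strictDefect_of_natCard_endCoinvariants_eq_one`**
  — -w4 g11's (B) output `Nat.card (EndCoinvariants (conjUnr κ M 𝔮 ∅ γ − 1)) = 1` («`(S_nr)_Γ = 0`») and -w7 g5's (Q≠0) output `N ≠ ⊤` give
  `¬ Finite Q` (through p691114 `StrictDefectInfinite.not_finite_quotient_of_forall_exists_sub_mem`; local nilpotence of `conj_γ − 1` on `S_nr` is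
  the tree's `KellerYin2024.isLocNil_conjUnr_sub_one`).
* §2 **`valuation_eq_add_of_natCard_endCoinvariants_eq_one`** — the class-(iii) reader END TO END: spine hypotheses (a Greenberg–Vatsal datum `Dnr`
  of `S_nr`, finitely generated torsion, `char = (H')`, `H'(0) ≠ 0`; any Agboola datum `D`) + a Prüfer-like receptacle `H` with endomorphism `ψ_H`,
  an equivariant INJECTION `j : Q ↪ H`, `#H^{ψ_H} = p ^ a`, `H_{ψ_H}` trivial (-w6 g4's `Def`; `a = E(key)`: `2` on `d ≡ 3 (8)`, `1` on `d ≡ 14 (16)` — scrit R113) + `(S_nr)_Γ = 0` (-w4 g11) + `N ≠ ⊤`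
  (-w7 g5) ⟹ `Module.Finite D.X ∧ ∃ n, D.HasCharValuationAt n ∧ ord_p H'(0) = n + a`; CM-summand instance **`…_endEigenPrimaryTorsion`**.
So on class (iii) the displayed arithmetic inputs of S3d are exactly: `j` (equivariant embedding of the defect quotient into the local group),
the two local cardinalities, `(S_nr)_Γ = 0`, and ONE unramified-not-strict class over the line. presearch: Greenberg LNM 1716 §4 p. 124 («`S_Γ = 0`»
nilpotence argument), Greenberg–Vatsal 2000 §2 Cor. 2.3 — source patterns; no new fact. beyond-print theorem: no.

References: [GreenbergVatsal2000] §2 Prop. 2.1, Cor. 2.3 (pp. 17–21); [GreenbergLNM1716] §4 Lemma 4.2, p. 124; [Agboola2007] §3 Prop. 3.2, §5.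
-/

noncomputable section

open scoped Classical
-- the summit namespace `Summit.BirchSwinnertonDyer.BirchSwinnertonDyer` repeats the problem name by design (D-0017)
set_option linter.dupNamespace false
set_option autoImplicit false

open NumberField IsDedekindDomain Field
open Literature.NumberTheory.EllipticCurves Literature.NumberTheory.EllipticCurves.GreenbergSelmer
open Literature.NumberTheory.EllipticCurves.GreenbergVatsal2000 Literature.NumberTheory.EllipticCurves.KellerYin2024
open Literature.NumberTheory.EllipticCurves.Agboola2007
open Literature.NumberTheory.EllipticCurves.IwasawaAlgebra Literature.NumberTheory.EllipticCurves.IwasawaDual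
open Literature.NumberTheory.GaloisRepresentations

universe u

namespace Summit.BirchSwinnertonDyer.BirchSwinnertonDyer.Theorems.PrintCf2.StrictDefect

/-! ## §1. `(S_nr)_Γ = 0` and `𝔖 ≠ S_nr` ⟹ the defect quotient is infinite -/

section Infinite

/-- **`#S_{ψ} = 1 ⟹ ψ` is onto** (`S_{ψ} = S ⧸ ψ(S)` has one element, so `ψ(S) = ⊤`). [folklore] -/
theorem surjective_of_natCard_endCoinvariants_eq_one {S : Type*} [AddCommGroup S] (ψ : AddMonoid.End S)
    (h : Nat.card (EndCoinvariants ψ) = 1) : ∀ s : S, ∃ t : S, ψ t = s := by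
  intro s
  have hsub : Subsingleton (EndCoinvariants ψ) := (Nat.card_eq_one_iff_unique.mp h).1
  have hmem : s ∈ AddMonoidHom.range (AddMonoidHomClass.toAddMonoidHom ψ) := by
    rw [← QuotientAddGroup.eq_zero_iff]
    exact Subsingleton.elim _ _
  obtain ⟨t, ht⟩ := hmem
  exact ⟨t, ht⟩

variable {K : Type u} [Field K] [NumberField K] {p : ℕ} [Fact p.Prime] {κ : ZpExtension K p}
  {M : Type u} [AddCommGroup M] [DistribMulAction (absoluteGaloisGroup K) M] [TopologicalSpace M] [DiscreteTopology M]
  {𝔮 : HeightOneSpectrum (𝓞 K)} {γ : absoluteGaloisGroup K}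

/-- **`(S_nr)_Γ = 0` and `𝔖 ≠ S_nr` ⟹ `Q = S_nr ⧸ 𝔖` is INFINITE.** For `M` `p`-primary with open stabilisers and `γ` a topological generator of the
line `κ` (so `conj_γ − 1` is locally nilpotent on `S_nr = H¹_{𝓕_nr}(K_∞, M)`, `KellerYin2024.isLocNil_conjUnr_sub_one`): if the `Γ`-coinvariants of
`S_nr` are trivial (`Nat.card (EndCoinvariants (conjUnr … γ − 1)) = 1`, -w4 g11's (B)) and `𝔖_𝔮(K_∞, M)` is a PROPER subgroup of `S_nr` (-w7 g5's (Q≠0)),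
then `S_nr ⧸ 𝔖` is infinite — -w7 g5's `StrictDefectInfinite.not_finite_quotient_of_forall_exists_sub_mem` (p691114) with its three inputs discharged
/ renamed. This is the hypothesis `hQ` of part III. [cite: GreenbergLNM1716, §4 p. 124] [cite: GreenbergVatsal2000, §2 Cor. 2.3 (pp. 20–21)] -/
theorem not_finite_strictDefect_of_natCard_endCoinvariants_eq_one (htor : ∀ m : M, ∃ k : ℕ, p ^ k • m = 0)
    (hstab : ∀ m : M, IsOpen (MulAction.stabilizer (absoluteGaloisGroup K) m : Set (absoluteGaloisGroup K)))
    (hγ : κ.IsTopGenerator γ)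
    (hcoinv : Nat.card (EndCoinvariants (conjUnr κ M 𝔮 (∅ : Set (HeightOneSpectrum (𝓞 K))) γ - 1)) = 1)
    (hne : (restrictedSelmerZp κ M 𝔮).addSubgroupOf (unrSelmer κ M 𝔮 ∅) ≠ ⊤) :
    ¬ Finite (unrSelmer κ M 𝔮 ∅ ⧸ (restrictedSelmerZp κ M 𝔮).addSubgroupOf (unrSelmer κ M 𝔮 ∅)) := by
  have hloc := isLocNil_conjUnr_sub_one κ 𝔮 (∅ : Set (HeightOneSpectrum (𝓞 K))) htor hstab hγ
  set φ : unrSelmer κ M 𝔮 ∅ →+ unrSelmer κ M 𝔮 ∅ := conjUnr κ M 𝔮 ∅ γ with hφ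
  refine StrictDefectInfinite.not_finite_quotient_of_forall_exists_sub_mem _ φ
    (fun s hs ↦ ?_) (fun s ↦ ?_) hne (fun s ↦ ?_)
  · -- `𝔖` is `conj_γ`-stable
    rw [AddSubgroup.mem_addSubgroupOf] at hs ⊢
    exact conjH1_mem_restrictedSelmerZp κ M 𝔮 γ hs
  · -- local nilpotence of `conj_γ − 1`
    obtain ⟨n, hn⟩ := hloc.nil s
    refine ⟨n, ?_⟩
    have hfun : ⇑(φ - AddMonoidHom.id (unrSelmer κ M 𝔮 ∅)) = ⇑(conjUnr κ M 𝔮 ∅ γ - 1) := funext fun _ ↦ rfl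
    rw [hfun, ← AddMonoid.End.coe_pow]
    exact hn
  · -- every class is a `conj_γ`-coboundary: `(S_nr)_Γ = 0`
    obtain ⟨t, ht⟩ := surjective_of_natCard_endCoinvariants_eq_one _ hcoinv s
    refine ⟨t, ?_⟩
    have hts : conjUnr κ M 𝔮 ∅ γ t - t = s := by
      rw [← ht, IwasawaDual.End_sub_apply, AddMonoid.End.one_apply]
    change conjUnr κ M 𝔮 ∅ γ t - t - s ∈ _
    rw [hts, sub_self]
    exact AddSubgroup.zero_mem _

end Infinite

/-! ## §2. Class (iii) END TO END: `(S_nr)_Γ = 0` ∧ `𝔖 ≠ S_nr` ∧ `Q ↪ H` Prüfer-like ∧ `#H^ψ = p^a`, `H_ψ = 0` ⟹ `ord_p H'(0) = n + a` -/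

section ClassThree

variable {K : Type u} [Field K] [NumberField K] {p : ℕ} [Fact p.Prime] {κ : ZpExtension K p}
  {M : Type u} [AddCommGroup M] [DistribMulAction (absoluteGaloisGroup K) M] [TopologicalSpace M] [DiscreteTopology M]
  {𝔮 : HeightOneSpectrum (𝓞 K)} {γ : absoluteGaloisGroup K}

/-- **S3d ON CLASS (iii), ALGEBRA COMPLETE.** Spine hypotheses (Greenberg–Vatsal datum `Dnr` of `S_nr` finitely generated torsion, `char = (H')`,
`H'(0) ≠ 0`; any Agboola datum `D`); a receptacle `H` with endomorphism `ψ_H` all of whose infinite subgroups are `⊤`, an equivariant INJECTION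
`j : Q ↪ H`, `#H^{ψ_H} = p ^ a` and `H_{ψ_H}` trivial (-w6 g4: `H = Def(κ, W*, v̄) ≅ W*`; `a = 2` on `d ≡ 3 (8)`, `a = 1` on `d ≡ 14 (16)`, scrit R113); `(S_nr)_Γ = 0` as `Nat.card (EndCoinvariants (conjUnr
… γ − 1)) = 1` (-w4 g11); `𝔖 ≠ S_nr` as `N ≠ ⊤` (-w7 g5). THEN `D.X` is finitely generated and `D.HasCharValuationAt n` with **`ord_p H'(0) = n + a`**.
[cite: GreenbergVatsal2000, §2 Prop. 2.1, Cor. 2.3, Prop. 2.4 (pp. 17–22)] [cite: GreenbergLNM1716, §4 Lemma 4.2, p. 124] [cite: Agboola2007, §3 Prop. 3.2, §5] -/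
theorem valuation_eq_add_of_natCard_endCoinvariants_eq_one (htor : ∀ m : M, ∃ k : ℕ, p ^ k • m = 0)
    (hstab : ∀ m : M, IsOpen (MulAction.stabilizer (absoluteGaloisGroup K) m : Set (absoluteGaloisGroup K)))
    (hγ : κ.IsTopGenerator γ) (Dnr : DatumDualData κ γ M (Castella2018.AcSelmer.bdpData M p 𝔮) ∅)
    [Module.Finite (IwasawaAlgebra p) Dnr.X] (hXtor : Module.IsTorsion (IwasawaAlgebra p) Dnr.X) {H' : IwasawaAlgebra p}
    (hH' : Module.charIdeal (IwasawaAlgebra p) Dnr.X = Ideal.span {H'}) (hH'0 : PowerSeries.constantCoeff H' ≠ 0)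
    (D : RestrictedDualData κ M 𝔮 γ) {H : Type*} [AddCommGroup H] (ψH : AddMonoid.End H)
    (hH : ∀ A : AddSubgroup H, ¬ Finite A → A = ⊤)
    (j : unrSelmer κ M 𝔮 ∅ ⧸ (restrictedSelmerZp κ M 𝔮).addSubgroupOf (unrSelmer κ M 𝔮 ∅) →+ H) (hj : Function.Injective j)
    (hje : ∀ q, j (QuotientAddGroup.map _ _
        ((conjUnr κ M 𝔮 ∅ γ - 1 : AddMonoid.End (unrSelmer κ M 𝔮 ∅)) : unrSelmer κ M 𝔮 ∅ →+ unrSelmer κ M 𝔮 ∅)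
        (addSubgroupOf_le_comap_conjUnr_sub_one κ M 𝔮 γ) q) = ψH (j q))
    {a : ℕ} (hinv : Nat.card (endInvariants ψH) = p ^ a) (hcoinvH : Subsingleton (EndCoinvariants ψH))
    (hcoinv : Nat.card (EndCoinvariants (conjUnr κ M 𝔮 (∅ : Set (HeightOneSpectrum (𝓞 K))) γ - 1)) = 1)
    (hne : (restrictedSelmerZp κ M 𝔮).addSubgroupOf (unrSelmer κ M 𝔮 ∅) ≠ ⊤) :
    Module.Finite (IwasawaAlgebra p) D.X ∧
    ∃ n : ℕ, D.HasCharValuationAt n ∧ (PowerSeries.constantCoeff H').valuation = n + a :=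
  valuation_eq_add_of_injective_of_not_finite htor hstab hγ Dnr hXtor hH' hH'0 D ψH hH j hj hje
    (not_finite_strictDefect_of_natCard_endCoinvariants_eq_one htor hstab hγ hcoinv hne) hinv hcoinvH

end ClassThree

/-! ## §3. The CM summand `W* = V.endEigenPrimaryTorsion p π r` -/

section Summand

variable {K : Type u} [Field K] [NumberField K] (V : WeierstrassCurve K) {p : ℕ} [Fact p.Prime] (π : V.endRing) (r : ℤ_[p])
  {κ : ZpExtension K p} {𝔮 : HeightOneSpectrum (𝓞 K)} {γ : absoluteGaloisGroup K}

/-- **Class (iii) END TO END for the CM summand** (`htor`/`hstab` discharged): the inputs are `Dnr` (finitely generated torsion, `char = (H')`,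
`H'(0) ≠ 0`), a Prüfer-like receptacle `H` with an equivariant injection of `Q = S_{W*}(K'_∞) ⧸ 𝔖_𝔮(K'_∞, W*)` and its two counts, `(S_{W*}(K'_∞))_Γ = 0`,
and `𝔖 ≠ S_{W*}(K'_∞)`; the output is `ord_p H'(0) = n + a` for every Agboola datum `D` (class (iii) of S3d: `a = 2` on `d ≡ 3 (8)`, `a = 1` on `d ≡ 14 (16)`).
[cite: GreenbergVatsal2000, §2 Cor. 2.3, Prop. 2.4] [cite: GreenbergLNM1716, §4 Lemma 4.2] -/
theorem valuation_eq_add_of_natCard_endCoinvariants_eq_one_endEigenPrimaryTorsion (hγ : κ.IsTopGenerator γ)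
    (Dnr : DatumDualData κ γ ↥(V.endEigenPrimaryTorsion p π r)
      (Castella2018.AcSelmer.bdpData ↥(V.endEigenPrimaryTorsion p π r) p 𝔮) ∅)
    [Module.Finite (IwasawaAlgebra p) Dnr.X] (hXtor : Module.IsTorsion (IwasawaAlgebra p) Dnr.X) {H' : IwasawaAlgebra p}
    (hH' : Module.charIdeal (IwasawaAlgebra p) Dnr.X = Ideal.span {H'}) (hH'0 : PowerSeries.constantCoeff H' ≠ 0)
    (D : RestrictedDualData κ ↥(V.endEigenPrimaryTorsion p π r) 𝔮 γ) {H : Type*} [AddCommGroup H] (ψH : AddMonoid.End H)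
    (hH : ∀ A : AddSubgroup H, ¬ Finite A → A = ⊤)
    (j : unrSelmer κ ↥(V.endEigenPrimaryTorsion p π r) 𝔮 ∅ ⧸
        (restrictedSelmerZp κ ↥(V.endEigenPrimaryTorsion p π r) 𝔮).addSubgroupOf (unrSelmer κ ↥(V.endEigenPrimaryTorsion p π r) 𝔮 ∅) →+ H)
    (hj : Function.Injective j)
    (hje : ∀ q, j (QuotientAddGroup.map _ _
        ((conjUnr κ ↥(V.endEigenPrimaryTorsion p π r) 𝔮 ∅ γ - 1 : AddMonoid.End (unrSelmer κ ↥(V.endEigenPrimaryTorsion p π r) 𝔮 ∅)) :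
          unrSelmer κ ↥(V.endEigenPrimaryTorsion p π r) 𝔮 ∅ →+ unrSelmer κ ↥(V.endEigenPrimaryTorsion p π r) 𝔮 ∅)
        (addSubgroupOf_le_comap_conjUnr_sub_one κ ↥(V.endEigenPrimaryTorsion p π r) 𝔮 γ) q) = ψH (j q))
    {a : ℕ} (hinv : Nat.card (endInvariants ψH) = p ^ a) (hcoinvH : Subsingleton (EndCoinvariants ψH))
    (hcoinv : Nat.card (EndCoinvariants
      (conjUnr κ ↥(V.endEigenPrimaryTorsion p π r) 𝔮 (∅ : Set (HeightOneSpectrum (𝓞 K))) γ - 1)) = 1)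
    (hne : (restrictedSelmerZp κ ↥(V.endEigenPrimaryTorsion p π r) 𝔮).addSubgroupOf
      (unrSelmer κ ↥(V.endEigenPrimaryTorsion p π r) 𝔮 ∅) ≠ ⊤) :
    Module.Finite (IwasawaAlgebra p) D.X ∧
    ∃ n : ℕ, D.HasCharValuationAt n ∧ (PowerSeries.constantCoeff H').valuation = n + a :=
  valuation_eq_add_of_natCard_endCoinvariants_eq_one (RestrictedSelmerPair.exists_pow_smul_endEigenPrimaryTorsion_eq_zero V p π r)
    (RestrictedSelmerPair.isOpen_stabilizer_endEigenPrimaryTorsion V p π r) hγ Dnr hXtor hH' hH'0 D ψH hH j hj hje hinv hcoinvH hcoinv hne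

end Summand

end Summit.BirchSwinnertonDyer.BirchSwinnertonDyer.Theorems.PrintCf2.StrictDefect

end
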